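import Literature.MathematicalPhysics.QuantumLattice.HubbardSectorPhaseSpaceCount
import Literature.MathematicalPhysics.QuantumLattice.HubbardEffectiveActionCT
import HarnessLib

/-!
# The infrared remainder of a frequency–momentum cutoff has a β-UNIFORM Gram constant given a density-of-states bound
# (the scale-`0` step of a Wilsonian flow with Salmhofer's cutoff `χ₂((ω² + e²)/Λ²)`; de Siqueira Pedra–Salmhofer 2008, Lemma 5.1)

Topic `MathematicalPhysics/QuantumLattice`; input of the single ultraviolet ("scale `0`") Gaussian step of the cell
gate-hubbard-kl's engine (crux K3 child `KLRegimeEngineV7`, stub `stub_engine_scale0`).  The scale-`0` covariance of the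
Hubbard torus in a counterterm frame `K` is `C^K_{>Λ} = w_Λ · C^K`, `w_Λ(k) = χ₂((ω² + e_K(k⃗)²)/Λ²)`
(`hubbardCovAboveCT`, `hubbardCutoffWeightCT`).  Writing `w_Λ = 1 - (1 - w_Λ)`, the full sharply truncated propagator obeys
the Pedra–Salmhofer determinant bound on the `4M` time grid (`MatsubaraTruncationGridGram`), and the INFRARED REMAINDER
`(1 - w_Λ(k))/(-iω + e_K(k⃗))` is a genuine Gram (convolution) kernel whose Fourier–Gram constant is the phase-space sum
of its symbol, `κ_IR² = (βL²)⁻¹ Σ_{(ω,k⃗)} (1 - w_Λ)/|{-iω} + e_K|` (`HubbardGridPropagatorGram`, `CutoffPropagatorGram`).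
This file bounds that sum.  Per mode `k⃗` on the Fermi curve the frequency sum is `(1/π) log(Λβ/π)` — NOT β-uniform; what
makes the average over `k⃗` uniform in `β` is a DENSITY-OF-STATES bound for the band down to the scale `π/β` (exactly the
term `∫ |φ| ln(1/max{|E|, π/β})` of de Siqueira Pedra–Salmhofer 2008, Lemma 5.1, in finite volume), together with `L ≳ β`
(the `O(L)` rounding term of every finite-volume level count):

* (private) `inv_max_le_dyadic_sum` — the pointwise dyadic majorant `1/max(a, b) ≤ Σ_{m ≤ m_top} (2/η_m)·[a < 2η_m]·[b < η_m]`,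
  `η_m = Λ 2^{-m}`, for `ω₀ ≤ a < Λ`, `b < Λ`, `η_{m_top} ≤ ω₀`;
* **`sum_one_sub_cutoff_div_sqrt_le`** — for a band `e : (ℤ/Lℤ)² → ℝ` with the level count
  `#{k⃗ : |e(k⃗)| < η} ≤ c₁ η L² + c₂ L` for `0 < η ≤ Λ`, `0 < β ≤ L` and `π/β ≤ Λ`:
  `Σ_{(i,k⃗)} (1 - χ₂((ω_i² + e(k⃗)²)/Λ²))/√(ω_i² + e(k⃗)²) ≤ (7 c₁ Λ + (Λ + 8) c₂) · β L²`, uniformly in the Matsubara cutoff `M`;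
* **`sum_one_sub_hubbardCutoffWeightCT_div_sqrt_le`** — the instance `e = e_K = nambuXiCT L μ K` (the frame band).

Everything is PROVED; no definition, no named fact.  (Elementary; the dyadic exchange of summations replaces the `log`.)

## References

* W. de Siqueira Pedra, M. Salmhofer, Comm. Math. Phys. 282 (2008) 797–818, Lemma 5.1 (the frequency split `C = C_{Ω,<} + C_{Ω,>}`
  and its Gram constant). [PedraSalmhofer2008]
* G. Benfatto, A. Giuliani, V. Mastropietro, Ann. Henri Poincaré 7 (2006) 809–898, §2.8 (2.80) (Gram constant = phase-space sum of the
  symbol). [BenfattoGiulianiMastropietro2006]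
-/

noncomputable section

namespace Literature.MathematicalPhysics.QuantumLattice

open Finset Literature.Probability.LatticeModels

/-! ### The pointwise dyadic majorant -/

/-- **Dyadic majorant of `1/max`.**  Let `0 < Λ`, `η_m = Λ·2^{-m}`, `ω₀ ≤ a < Λ` with `0 < ω₀`, `b < Λ`, and `η_{m_top} ≤ ω₀`.
Then `1/max(a,b) ≤ Σ_{m ≤ m_top} (2/η_m)·[a < 2η_m ∧ b < η_m]` (take the largest qualifying `m`; the next level fails, or
`m = m_top` and `a ≥ η_{m_top}`). [folklore] -/
private theorem inv_max_le_dyadic_sum {Λ ω₀ a b : ℝ} (hΛ : 0 < Λ) (hω₀ : 0 < ω₀) (ha : ω₀ ≤ a) (haΛ : a < Λ)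
    (hbΛ : b < Λ) {m_top : ℕ} (htop : Λ * ((2 : ℝ) ^ m_top)⁻¹ ≤ ω₀) :
    1 / max a b ≤ ∑ m ∈ range (m_top + 1),
      2 / (Λ * ((2 : ℝ) ^ m)⁻¹) * (if a < 2 * (Λ * ((2 : ℝ) ^ m)⁻¹) ∧ b < Λ * ((2 : ℝ) ^ m)⁻¹ then 1 else 0) := by
  classical
  set η : ℕ → ℝ := fun m => Λ * ((2 : ℝ) ^ m)⁻¹ with hη
  have hηpos : ∀ m, 0 < η m := fun m => by positivity
  have hηsucc : ∀ m, η (m + 1) = η m / 2 := fun m => by simp only [hη, pow_succ, mul_inv]; ring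
  set J := (range (m_top + 1)).filter (fun m => a < 2 * η m ∧ b < η m) with hJ
  have h0J : 0 ∈ J := by
    refine mem_filter.2 ⟨mem_range.2 (Nat.succ_pos _), ?_, ?_⟩
    · simp only [hη, pow_zero, inv_one, mul_one]; linarith
    · simpa [hη] using hbΛ
  have hJne : J.Nonempty := ⟨0, h0J⟩
  set j := J.max' hJne with hj
  have hjJ : j ∈ J := J.max'_mem hJne
  have hjtop : j ≤ m_top := Nat.lt_succ_iff.1 (mem_range.1 (mem_filter.1 hjJ).1)
  have hja : a < 2 * η j := (mem_filter.1 hjJ).2.1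
  have hjb : b < η j := (mem_filter.1 hjJ).2.2
  have hmax_pos : 0 < max a b := lt_of_lt_of_le (lt_of_lt_of_le hω₀ ha) (le_max_left _ _)
  -- the key inequality: `η j / 2 ≤ max a b`
  have hkey : η j / 2 ≤ max a b := by
    rcases Nat.lt_or_ge j m_top with hlt | hge
    · -- `j + 1 ∉ J`
      have hnot : ¬ (a < 2 * η (j + 1) ∧ b < η (j + 1)) := by
        intro hcon
        have hmem : j + 1 ∈ J := mem_filter.2 ⟨mem_range.2 (Nat.succ_lt_succ hlt), hcon⟩
        have := J.le_max' (j + 1) hmem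
        rw [← hj] at this
        omega
      rw [hηsucc] at hnot
      rcases not_and_or.1 hnot with h1 | h2
      · have : η j ≤ a := by push Not at h1; linarith
        linarith [le_max_left a b, hηpos j]
      · push Not at h2
        exact h2.trans (le_max_right _ _)
    · have hjeq : j = m_top := le_antisymm hjtop hge
      have : η j ≤ a := by rw [hjeq]; exact htop.trans ha
      linarith [le_max_left a b, hηpos j]
  -- hence `1/max ≤ 2/η j ≤` the `j`-th term `≤` the sum
  have hterm : 1 / max a b ≤ 2 / η j := by
    rw [div_le_div_iff₀ hmax_pos (hηpos j)]
    linarith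
  refine hterm.trans ?_
  have hsingle : 2 / η j = 2 / η j * (if a < 2 * η j ∧ b < η j then 1 else 0) := by
    rw [if_pos ⟨hja, hjb⟩, mul_one]
  rw [hsingle]
  refine single_le_sum (f := fun m => 2 / η m * (if a < 2 * η m ∧ b < η m then 1 else 0)) (fun m _ => ?_)
    (mem_filter.1 hjJ).1
  have := hηpos m
  split_ifs <;> positivity

/-! ### Geometric sums of the dyadic levels -/

/-- `Σ_{m<T} Λ 2^{-m} ≤ 2Λ`. [folklore] -/
private theorem sum_dyadic_le {Λ : ℝ} (hΛ : 0 ≤ Λ) (T : ℕ) : ∑ m ∈ range T, Λ * ((2 : ℝ) ^ m)⁻¹ ≤ 2 * Λ := by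
  rw [← mul_sum]
  have h : ∑ m ∈ range T, ((2 : ℝ) ^ m)⁻¹ ≤ 2 := by
    have h' : ∑ m ∈ range T, ((2 : ℝ) ^ m)⁻¹ = ∑ m ∈ range T, (1 / 2 : ℝ) ^ m :=
      sum_congr rfl fun m _ => by rw [one_div, inv_pow]
    rw [h', geom_sum_eq (by norm_num : (1 / 2 : ℝ) ≠ 1), div_le_iff_of_neg (by norm_num : (1 / 2 : ℝ) - 1 < 0)]
    have hp : (0 : ℝ) ≤ (1 / 2 : ℝ) ^ T := by positivity
    linarith
  calc Λ * ∑ m ∈ range T, ((2 : ℝ) ^ m)⁻¹ ≤ Λ * 2 := mul_le_mul_of_nonneg_left h hΛ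
    _ = 2 * Λ := mul_comm _ _

/-- `Σ_{m<T} (Λ 2^{-m})⁻¹ = (2^T - 1)/Λ ≤ 2^T/Λ`. [folklore] -/
private theorem sum_inv_dyadic_le {Λ : ℝ} (hΛ : 0 < Λ) (T : ℕ) : ∑ m ∈ range T, (Λ * ((2 : ℝ) ^ m)⁻¹)⁻¹ ≤ (2 : ℝ) ^ T / Λ := by
  have h' : ∑ m ∈ range T, (Λ * ((2 : ℝ) ^ m)⁻¹)⁻¹ = Λ⁻¹ * ∑ m ∈ range T, (2 : ℝ) ^ m := by
    rw [mul_sum]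
    exact sum_congr rfl fun m _ => by rw [mul_inv, inv_inv]
  rw [h', geom_sum_eq (by norm_num : (2 : ℝ) ≠ 1)]
  have h1 : ((2 : ℝ) ^ T - 1) / (2 - 1) ≤ (2 : ℝ) ^ T := by norm_num
  calc Λ⁻¹ * (((2 : ℝ) ^ T - 1) / (2 - 1)) ≤ Λ⁻¹ * (2 : ℝ) ^ T := mul_le_mul_of_nonneg_left h1 (inv_nonneg.2 hΛ.le)
    _ = (2 : ℝ) ^ T / Λ := by rw [div_eq_inv_mul]

/-! ### The β-uniform bound -/

/-- **The infrared cutoff remainder has a β-uniform phase-space sum given a density-of-states bound.**  For a band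
`e : (ℤ/Lℤ)² → ℝ` with `#{k⃗ : |e k⃗| < η} ≤ c₁ η L² + c₂ L` for all `0 < η ≤ Λ`, and `0 < β ≤ L`, `π/β ≤ Λ`:
`Σ_{(i,k⃗) ∈ MatsubaraIdx M × (ℤ/Lℤ)²} (1 - χ₂((ω_i² + e(k⃗)²)/Λ²))/√(ω_i² + e(k⃗)²) ≤ (7c₁Λ + (Λ + 8)c₂)·βL²` for every `M`
(each summand vanishes unless `|ω_i|, |e| < Λ`, and is `≤ 1/max(|ω_i|, |e|)`; the dyadic majorant, the exchange of the two
summations, the frequency count `#{|ω_i| < 2η} ≤ 2ηβ/π + 3` and the level count at each dyadic level `η_m = Λ2^{-m} ≥ π/(2β)`).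
[cite: PedraSalmhofer2008, Lemma 5.1] -/
theorem sum_one_sub_cutoff_div_sqrt_le {L M : ℕ} [NeZero L] {β : ℝ} (hβ : 0 < β) (e : TorusSite 2 L → ℝ) {Λ c₁ c₂ : ℝ}
    (hΛ : 0 < Λ) (hΛβ : Real.pi / β ≤ Λ) (hβL : β ≤ L) (hc₁ : 0 ≤ c₁) (hc₂ : 0 ≤ c₂)
    (hcount : ∀ η : ℝ, 0 < η → η ≤ Λ →
      (((univ : Finset (TorusSite 2 L)).filter fun k => |e k| < η).card : ℝ) ≤ c₁ * η * (L : ℝ) ^ 2 + c₂ * L) :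
    ∑ k : FreqMomentum L M, (1 - salmhoferCutoff ((matsubaraFreq β M k.1 ^ 2 + e k.2 ^ 2) / Λ ^ 2)) /
        Real.sqrt (matsubaraFreq β M k.1 ^ 2 + e k.2 ^ 2) ≤
      (7 * c₁ * Λ + (Λ + 8) * c₂) * β * (L : ℝ) ^ 2 := by
  classical
  have hπ := Real.pi_pos
  have hL : (0 : ℝ) < L := lt_of_lt_of_le hβ hβL
  set ω₀ : ℝ := Real.pi / β with hω₀
  have hω₀pos : 0 < ω₀ := by positivity
  set η : ℕ → ℝ := fun m => Λ * ((2 : ℝ) ^ m)⁻¹ with hη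
  have hηpos : ∀ m, 0 < η m := fun m => by positivity
  have hηle : ∀ m, η m ≤ Λ := fun m => by
    have h2 : (1 : ℝ) ≤ (2 : ℝ) ^ m := one_le_pow₀ (by norm_num)
    calc η m = Λ * ((2 : ℝ) ^ m)⁻¹ := rfl
      _ ≤ Λ * 1 := mul_le_mul_of_nonneg_left (inv_le_one_of_one_le₀ h2) hΛ.le
      _ = Λ := mul_one _
  -- the top level: the least `T` with `Λ 2^{-T} ≤ ω₀`; then `2^T ≤ 2Λ/ω₀ = 2Λβ/π`
  have hex : ∃ T : ℕ, Λ * ((2 : ℝ) ^ T)⁻¹ ≤ ω₀ := by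
    obtain ⟨T, hT⟩ := pow_unbounded_of_one_lt (Λ / ω₀) (by norm_num : (1 : ℝ) < 2)
    refine ⟨T, ?_⟩
    rw [div_lt_iff₀ hω₀pos] at hT
    have h2 : (0 : ℝ) < (2 : ℝ) ^ T := by positivity
    rw [mul_inv_le_iff₀ h2]
    linarith
  set T := Nat.find hex with hTdef
  have hT : Λ * ((2 : ℝ) ^ T)⁻¹ ≤ ω₀ := Nat.find_spec hex
  have h2T : (2 : ℝ) ^ T ≤ 2 * Λ / ω₀ := by
    rcases Nat.eq_zero_or_pos T with hT0 | hTpos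
    · rw [hT0, pow_zero, le_div_iff₀ hω₀pos]
      have : ω₀ ≤ Λ := hΛβ
      linarith
    · have hmin : ¬ (Λ * ((2 : ℝ) ^ (T - 1))⁻¹ ≤ ω₀) := Nat.find_min hex (by omega)
      push Not at hmin
      have h2 : (0 : ℝ) < (2 : ℝ) ^ (T - 1) := by positivity
      rw [lt_mul_inv_iff₀ h2] at hmin
      have hpow : (2 : ℝ) ^ T = 2 * (2 : ℝ) ^ (T - 1) := by
        rw [← pow_succ']
        congr 1
        omega
      rw [hpow, le_div_iff₀ hω₀pos]
      nlinarith
  have h2T' : (2 : ℝ) ^ T ≤ 2 * Λ * β / Real.pi := by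
    have : 2 * Λ / ω₀ = 2 * Λ * β / Real.pi := by rw [hω₀]; field_simp
    rw [← this]; exact h2T
  have hT1 : ((T : ℝ) + 1) ≤ (2 : ℝ) ^ T := by
    have h : T + 1 ≤ 2 ^ T := Nat.succ_le_of_lt T.lt_two_pow_self
    exact_mod_cast h
  -- pointwise majorant
  set ind : ℕ → FreqMomentum L M → ℝ := fun m k =>
    if |matsubaraFreq β M k.1| < 2 * η m ∧ |e k.2| < η m then 1 else 0 with hind
  have hpt : ∀ k : FreqMomentum L M,
      (1 - salmhoferCutoff ((matsubaraFreq β M k.1 ^ 2 + e k.2 ^ 2) / Λ ^ 2)) /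
          Real.sqrt (matsubaraFreq β M k.1 ^ 2 + e k.2 ^ 2) ≤
        ∑ m ∈ range (T + 1), 2 / η m * ind m k := by
    intro k
    set ω := matsubaraFreq β M k.1 with hω
    set ξ := e k.2 with hξ
    have hwmem := salmhoferCutoff_mem_Icc ((ω ^ 2 + ξ ^ 2) / Λ ^ 2)
    have hRHS0 : 0 ≤ ∑ m ∈ range (T + 1), 2 / η m * ind m k := sum_nonneg fun m _ => by
      have := hηpos m
      simp only [hind]
      split_ifs <;> positivity
    by_cases hlt : ω ^ 2 + ξ ^ 2 < Λ ^ 2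
    · -- both `|ω| < Λ` and `|ξ| < Λ`
      have hωΛ : |ω| < Λ := abs_lt.2 (abs_lt_of_sq_lt_sq' (by nlinarith [sq_nonneg ξ] : ω ^ 2 < Λ ^ 2) hΛ.le)
      have hξΛ : |ξ| < Λ := abs_lt.2 (abs_lt_of_sq_lt_sq' (by nlinarith [sq_nonneg ω] : ξ ^ 2 < Λ ^ 2) hΛ.le)
      have hωlow : ω₀ ≤ |ω| := pi_div_le_abs_matsubaraFreq hβ k.1
      have hsqrt : max |ω| |ξ| ≤ Real.sqrt (ω ^ 2 + ξ ^ 2) := by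
        refine max_le ?_ ?_
        · rw [← Real.sqrt_sq_eq_abs]; exact Real.sqrt_le_sqrt (by nlinarith [sq_nonneg ξ])
        · rw [← Real.sqrt_sq_eq_abs]; exact Real.sqrt_le_sqrt (by nlinarith [sq_nonneg ω])
      have hmaxpos : 0 < max |ω| |ξ| := lt_of_lt_of_le (lt_of_lt_of_le hω₀pos hωlow) (le_max_left _ _)
      calc (1 - salmhoferCutoff ((ω ^ 2 + ξ ^ 2) / Λ ^ 2)) / Real.sqrt (ω ^ 2 + ξ ^ 2)
          ≤ 1 / Real.sqrt (ω ^ 2 + ξ ^ 2) := by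
            refine div_le_div_of_nonneg_right (by linarith [hwmem.1]) (Real.sqrt_nonneg _)
        _ ≤ 1 / max |ω| |ξ| := one_div_le_one_div_of_le hmaxpos hsqrt
        _ ≤ ∑ m ∈ range (T + 1), 2 / (Λ * ((2 : ℝ) ^ m)⁻¹) *
              (if |ω| < 2 * (Λ * ((2 : ℝ) ^ m)⁻¹) ∧ |ξ| < Λ * ((2 : ℝ) ^ m)⁻¹ then 1 else 0) :=
            inv_max_le_dyadic_sum hΛ hω₀pos hωlow hωΛ hξΛ hT
        _ = ∑ m ∈ range (T + 1), 2 / η m * ind m k := by simp only [hind, hη, hω, hξ]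
    · -- the weight is `1`: the summand vanishes
      have hw1 : salmhoferCutoff ((ω ^ 2 + ξ ^ 2) / Λ ^ 2) = 1 := by
        refine salmhoferCutoff_of_ge ?_
        rw [le_div_iff₀ (by positivity)]
        linarith
      rw [hw1, sub_self, zero_div]
      exact hRHS0
  -- sum the majorant, exchange the summations, count
  have hcountω : ∀ m, ((((univ : Finset (MatsubaraIdx M)).filter fun i => |matsubaraFreq β M i| < 2 * η m).card : ℕ) : ℝ) ≤
      2 * η m * β / Real.pi + 3 := fun m =>
    card_filter_matsubaraFreq_le hβ (by have := hηpos m; positivity) _ fun i hi => (mem_filter.1 hi).2.le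
  have hcountk : ∀ m, ((((univ : Finset (TorusSite 2 L)).filter fun k => |e k| < η m).card : ℕ) : ℝ) ≤
      c₁ * η m * (L : ℝ) ^ 2 + c₂ * L := fun m => hcount (η m) (hηpos m) (hηle m)
  have hsumind : ∀ m, ∑ k : FreqMomentum L M, ind m k =
      ((((univ : Finset (MatsubaraIdx M)).filter fun i => |matsubaraFreq β M i| < 2 * η m).card : ℕ) : ℝ) *
        ((((univ : Finset (TorusSite 2 L)).filter fun k => |e k| < η m).card : ℕ) : ℝ) := by
    intro m
    simp only [hind]
    rw [sum_boole, ← Nat.cast_mul, ← card_filter_freqMomentum_eq]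
  calc ∑ k : FreqMomentum L M, (1 - salmhoferCutoff ((matsubaraFreq β M k.1 ^ 2 + e k.2 ^ 2) / Λ ^ 2)) /
          Real.sqrt (matsubaraFreq β M k.1 ^ 2 + e k.2 ^ 2)
      ≤ ∑ k : FreqMomentum L M, ∑ m ∈ range (T + 1), 2 / η m * ind m k := sum_le_sum fun k _ => hpt k
    _ = ∑ m ∈ range (T + 1), 2 / η m * ∑ k : FreqMomentum L M, ind m k := by
        rw [sum_comm]; exact sum_congr rfl fun m _ => by rw [mul_sum]
    _ ≤ ∑ m ∈ range (T + 1), 2 / η m * ((2 * η m * β / Real.pi + 3) * (c₁ * η m * (L : ℝ) ^ 2 + c₂ * L)) := by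
        refine sum_le_sum fun m _ => mul_le_mul_of_nonneg_left ?_ (by have := hηpos m; positivity)
        rw [hsumind]
        exact mul_le_mul (hcountω m) (hcountk m) (Nat.cast_nonneg _) (by have := hηpos m; positivity)
    _ = ∑ m ∈ range (T + 1), ((4 * c₁ * β * (L : ℝ) ^ 2 / Real.pi) * η m +
          (6 * c₁ * (L : ℝ) ^ 2 + 4 * c₂ * β * L / Real.pi) + (6 * c₂ * L) * (η m)⁻¹) := by
        refine sum_congr rfl fun m _ => ?_
        have := (hηpos m).ne'
        field_simp
        ring
    _ = (4 * c₁ * β * (L : ℝ) ^ 2 / Real.pi) * ∑ m ∈ range (T + 1), η m +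
          ((T : ℝ) + 1) * (6 * c₁ * (L : ℝ) ^ 2 + 4 * c₂ * β * L / Real.pi) +
          (6 * c₂ * L) * ∑ m ∈ range (T + 1), (η m)⁻¹ := by
        rw [sum_add_distrib, sum_add_distrib, sum_const, card_range, nsmul_eq_mul, Nat.cast_add, Nat.cast_one,
          mul_sum, mul_sum]
    _ ≤ (4 * c₁ * β * (L : ℝ) ^ 2 / Real.pi) * (2 * Λ) +
          (2 * Λ * β / Real.pi) * (6 * c₁ * (L : ℝ) ^ 2 + 4 * c₂ * β * L / Real.pi) +
          (6 * c₂ * L) * (4 * β / Real.pi) := by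
        have hA : ∑ m ∈ range (T + 1), η m ≤ 2 * Λ := sum_dyadic_le hΛ.le (T + 1)
        have hB : ((T : ℝ) + 1) ≤ 2 * Λ * β / Real.pi := hT1.trans h2T'
        have hC : ∑ m ∈ range (T + 1), (η m)⁻¹ ≤ 4 * β / Real.pi := by
          refine (sum_inv_dyadic_le hΛ (T + 1)).trans ?_
          rw [pow_succ, div_le_iff₀ hΛ]
          calc (2 : ℝ) ^ T * 2 ≤ 2 * Λ * β / Real.pi * 2 := by nlinarith
            _ = 4 * β / Real.pi * Λ := by ring
        gcongr
    _ ≤ (7 * c₁ * Λ + (Λ + 8) * c₂) * β * (L : ℝ) ^ 2 := by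
        have hπ3 : (3 : ℝ) ≤ Real.pi := Real.pi_gt_three.le
        have hπne : Real.pi ≠ 0 := hπ.ne'
        have hL1 : (1 : ℝ) ≤ L := by exact_mod_cast Nat.one_le_iff_ne_zero.2 (NeZero.ne L)
        have hX : 0 ≤ c₁ * Λ * β * (L : ℝ) ^ 2 := by positivity
        have hY : 0 ≤ Λ * c₂ * β ^ 2 * L := by positivity
        have hZ : 0 ≤ c₂ * β * L := by positivity
        have h1 : (4 * c₁ * β * (L : ℝ) ^ 2 / Real.pi) * (2 * Λ) + (2 * Λ * β / Real.pi) * (6 * c₁ * (L : ℝ) ^ 2) ≤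
            7 * c₁ * Λ * β * (L : ℝ) ^ 2 := by
          have e : (4 * c₁ * β * (L : ℝ) ^ 2 / Real.pi) * (2 * Λ) + (2 * Λ * β / Real.pi) * (6 * c₁ * (L : ℝ) ^ 2) =
              20 * (c₁ * Λ * β * (L : ℝ) ^ 2) / Real.pi := by
            field_simp
            ring
          rw [e]
          calc 20 * (c₁ * Λ * β * (L : ℝ) ^ 2) / Real.pi ≤ 20 * (c₁ * Λ * β * (L : ℝ) ^ 2) / 3 :=
                div_le_div_of_nonneg_left (by positivity) (by norm_num) hπ3
            _ ≤ 7 * c₁ * Λ * β * (L : ℝ) ^ 2 := by linarith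
        have h2 : (2 * Λ * β / Real.pi) * (4 * c₂ * β * L / Real.pi) ≤ Λ * c₂ * β * (L : ℝ) ^ 2 := by
          have e : (2 * Λ * β / Real.pi) * (4 * c₂ * β * L / Real.pi) = 8 * (Λ * c₂ * β ^ 2 * L) / Real.pi ^ 2 := by
            field_simp
            ring
          rw [e]
          have hπ9 : (9 : ℝ) ≤ Real.pi ^ 2 := by
            have h := pow_le_pow_left₀ (by norm_num : (0 : ℝ) ≤ 3) hπ3 2
            norm_num at h
            exact h
          have hβ2 : Λ * c₂ * β ^ 2 * L ≤ Λ * c₂ * β * (L : ℝ) ^ 2 := by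
            have : β ^ 2 * (L : ℝ) ≤ β * (L : ℝ) ^ 2 := by
              have e1 : β * (L : ℝ) ^ 2 - β ^ 2 * L = β * L * (L - β) := by ring
              have e2 : 0 ≤ β * L * ((L : ℝ) - β) := mul_nonneg (mul_nonneg hβ.le hL.le) (sub_nonneg.2 hβL)
              linarith
            calc Λ * c₂ * β ^ 2 * L = Λ * c₂ * (β ^ 2 * L) := by ring
              _ ≤ Λ * c₂ * (β * (L : ℝ) ^ 2) := mul_le_mul_of_nonneg_left this (by positivity)
              _ = Λ * c₂ * β * (L : ℝ) ^ 2 := by ring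
          calc 8 * (Λ * c₂ * β ^ 2 * L) / Real.pi ^ 2 ≤ 8 * (Λ * c₂ * β ^ 2 * L) / 9 :=
                div_le_div_of_nonneg_left (by positivity) (by norm_num) hπ9
            _ ≤ Λ * c₂ * β * (L : ℝ) ^ 2 := by linarith
        have h3 : (6 * c₂ * L) * (4 * β / Real.pi) ≤ 8 * c₂ * β * (L : ℝ) ^ 2 := by
          have e : (6 * c₂ * L) * (4 * β / Real.pi) = 24 * (c₂ * β * L) / Real.pi := by
            field_simp
            ring
          rw [e]
          have hL2 : c₂ * β * L ≤ c₂ * β * (L : ℝ) ^ 2 := by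
            have : (L : ℝ) ≤ (L : ℝ) ^ 2 := by
              have e1 : (L : ℝ) ^ 2 - L = L * (L - 1) := by ring
              have e2 : 0 ≤ (L : ℝ) * (L - 1) := mul_nonneg hL.le (sub_nonneg.2 hL1)
              linarith
            exact mul_le_mul_of_nonneg_left this (by positivity)
          calc 24 * (c₂ * β * L) / Real.pi ≤ 24 * (c₂ * β * L) / 3 :=
                div_le_div_of_nonneg_left (by positivity) (by norm_num) hπ3
            _ ≤ 8 * c₂ * β * (L : ℝ) ^ 2 := by linarith
        have e4 : (7 * c₁ * Λ + (Λ + 8) * c₂) * β * (L : ℝ) ^ 2 =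
            7 * c₁ * Λ * β * (L : ℝ) ^ 2 + Λ * c₂ * β * (L : ℝ) ^ 2 + 8 * c₂ * β * (L : ℝ) ^ 2 := by ring
        have e5 : (4 * c₁ * β * (L : ℝ) ^ 2 / Real.pi) * (2 * Λ) +
            (2 * Λ * β / Real.pi) * (6 * c₁ * (L : ℝ) ^ 2 + 4 * c₂ * β * L / Real.pi) + (6 * c₂ * L) * (4 * β / Real.pi) =
            ((4 * c₁ * β * (L : ℝ) ^ 2 / Real.pi) * (2 * Λ) + (2 * Λ * β / Real.pi) * (6 * c₁ * (L : ℝ) ^ 2)) +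
              (2 * Λ * β / Real.pi) * (4 * c₂ * β * L / Real.pi) + (6 * c₂ * L) * (4 * β / Real.pi) := by ring
        rw [e4, e5]
        linarith

/-- **The frame-band instance**: for the renormalised band `e_K = nambuXiCT L μ K` of a counterterm frame `K` with the level count
`#{k⃗ : |e_K(k⃗)| < η} ≤ c₁ηL² + c₂L` (`0 < η ≤ Λ`), `0 < β ≤ L` and `π/β ≤ Λ`, the phase-space sum of the infrared remainder of
`hubbardCutoffWeightCT … Λ` is `≤ (7c₁Λ + (Λ + 8)c₂)·βL²`, uniformly in `M` — i.e. the infrared Gram block of the scale-`Λ` covariance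
`hubbardCovAboveCT` has Gram constant `κ_IR² ≤ 7c₁Λ + (Λ + 8)c₂` per unit `βL²`. [cite: PedraSalmhofer2008, Lemma 5.1] -/
theorem sum_one_sub_hubbardCutoffWeightCT_div_sqrt_le {L M : ℕ} [NeZero L] {β : ℝ} (hβ : 0 < β) (μ : ℝ) (K : TrigPolyC4v)
    {Λ c₁ c₂ : ℝ} (hΛ : 0 < Λ) (hΛβ : Real.pi / β ≤ Λ) (hβL : β ≤ L) (hc₁ : 0 ≤ c₁) (hc₂ : 0 ≤ c₂)
    (hcount : ∀ η : ℝ, 0 < η → η ≤ Λ →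
      (((univ : Finset (TorusSite 2 L)).filter fun k => |nambuXiCT L μ K k| < η).card : ℝ) ≤ c₁ * η * (L : ℝ) ^ 2 + c₂ * L) :
    ∑ k : FreqMomentum L M, (1 - hubbardCutoffWeightCT L M β μ K Λ k) /
        Real.sqrt (matsubaraFreq β M k.1 ^ 2 + nambuXiCT L μ K k.2 ^ 2) ≤
      (7 * c₁ * Λ + (Λ + 8) * c₂) * β * (L : ℝ) ^ 2 :=
  sum_one_sub_cutoff_div_sqrt_le hβ (nambuXiCT L μ K) hΛ hΛβ hβL hc₁ hc₂ hcount

/-! ### The SCALE-LINEAR form (uniform down the multiscale ladder)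

The `8c₂` of `sum_one_sub_cutoff_div_sqrt_le` is the finite-volume rounding term `c₂L` of the level count paid once per unit `βL²`; it is
not linear in `Λ`, so per unit of the natural size `Λ·βL²` it grows like `Λ⁻¹` down a ladder of scales `Λ = Λ_n → π/β`.  The SAME hypotheses
already cure this: `π/β ≤ Λ` and `β ≤ L` give `Λ·L ≥ π`, so `c₂L ≤ (c₂/π)·Λ·L²`, and the whole sum is `≤ (7c₁ + 4c₂)·Λ·βL²` — linear in `Λ`
with absolute constants (the form a multiscale consumer needs: hard line `≤ 2/Λ` times this soft phase-space sum is scale-free). -/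

/-- **Scale-linear form of the infrared phase-space sum.**  Under the hypotheses of `sum_one_sub_cutoff_div_sqrt_le`
(`#{k⃗ : |e k⃗| < η} ≤ c₁ηL² + c₂L` for `0 < η ≤ Λ`, `0 < β ≤ L`, `π/β ≤ Λ`):
`Σ_{(i,k⃗)} (1 - χ₂((ω_i² + e(k⃗)²)/Λ²))/√(ω_i² + e(k⃗)²) ≤ (7c₁ + 4c₂)·Λ·βL²`, uniformly in `M` (the rounding term is absorbed by `ΛL ≥ π`).
[cite: PedraSalmhofer2008, Lemma 5.1] -/
theorem sum_one_sub_cutoff_div_sqrt_le_linear {L M : ℕ} [NeZero L] {β : ℝ} (hβ : 0 < β) (e : TorusSite 2 L → ℝ) {Λ c₁ c₂ : ℝ}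
    (hΛ : 0 < Λ) (hΛβ : Real.pi / β ≤ Λ) (hβL : β ≤ L) (hc₁ : 0 ≤ c₁) (hc₂ : 0 ≤ c₂)
    (hcount : ∀ η : ℝ, 0 < η → η ≤ Λ →
      (((univ : Finset (TorusSite 2 L)).filter fun k => |e k| < η).card : ℝ) ≤ c₁ * η * (L : ℝ) ^ 2 + c₂ * L) :
    ∑ k : FreqMomentum L M, (1 - salmhoferCutoff ((matsubaraFreq β M k.1 ^ 2 + e k.2 ^ 2) / Λ ^ 2)) /
        Real.sqrt (matsubaraFreq β M k.1 ^ 2 + e k.2 ^ 2) ≤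
      (7 * c₁ + 4 * c₂) * Λ * β * (L : ℝ) ^ 2 := by
  classical
  have hπ := Real.pi_pos
  have hL : (0 : ℝ) < L := lt_of_lt_of_le hβ hβL
  set ω₀ : ℝ := Real.pi / β with hω₀
  have hω₀pos : 0 < ω₀ := by positivity
  set η : ℕ → ℝ := fun m => Λ * ((2 : ℝ) ^ m)⁻¹ with hη
  have hηpos : ∀ m, 0 < η m := fun m => by positivity
  have hηle : ∀ m, η m ≤ Λ := fun m => by
    have h2 : (1 : ℝ) ≤ (2 : ℝ) ^ m := one_le_pow₀ (by norm_num)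
    calc η m = Λ * ((2 : ℝ) ^ m)⁻¹ := rfl
      _ ≤ Λ * 1 := mul_le_mul_of_nonneg_left (inv_le_one_of_one_le₀ h2) hΛ.le
      _ = Λ := mul_one _
  -- the top level: the least `T` with `Λ 2^{-T} ≤ ω₀`; then `2^T ≤ 2Λ/ω₀ = 2Λβ/π`
  have hex : ∃ T : ℕ, Λ * ((2 : ℝ) ^ T)⁻¹ ≤ ω₀ := by
    obtain ⟨T, hT⟩ := pow_unbounded_of_one_lt (Λ / ω₀) (by norm_num : (1 : ℝ) < 2)
    refine ⟨T, ?_⟩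
    rw [div_lt_iff₀ hω₀pos] at hT
    have h2 : (0 : ℝ) < (2 : ℝ) ^ T := by positivity
    rw [mul_inv_le_iff₀ h2]
    linarith
  set T := Nat.find hex with hTdef
  have hT : Λ * ((2 : ℝ) ^ T)⁻¹ ≤ ω₀ := Nat.find_spec hex
  have h2T : (2 : ℝ) ^ T ≤ 2 * Λ / ω₀ := by
    rcases Nat.eq_zero_or_pos T with hT0 | hTpos
    · rw [hT0, pow_zero, le_div_iff₀ hω₀pos]
      have : ω₀ ≤ Λ := hΛβ
      linarith
    · have hmin : ¬ (Λ * ((2 : ℝ) ^ (T - 1))⁻¹ ≤ ω₀) := Nat.find_min hex (by omega)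
      push Not at hmin
      have h2 : (0 : ℝ) < (2 : ℝ) ^ (T - 1) := by positivity
      rw [lt_mul_inv_iff₀ h2] at hmin
      have hpow : (2 : ℝ) ^ T = 2 * (2 : ℝ) ^ (T - 1) := by
        rw [← pow_succ']
        congr 1
        omega
      rw [hpow, le_div_iff₀ hω₀pos]
      nlinarith
  have h2T' : (2 : ℝ) ^ T ≤ 2 * Λ * β / Real.pi := by
    have : 2 * Λ / ω₀ = 2 * Λ * β / Real.pi := by rw [hω₀]; field_simp
    rw [← this]; exact h2T
  have hT1 : ((T : ℝ) + 1) ≤ (2 : ℝ) ^ T := by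
    have h : T + 1 ≤ 2 ^ T := Nat.succ_le_of_lt T.lt_two_pow_self
    exact_mod_cast h
  -- pointwise majorant
  set ind : ℕ → FreqMomentum L M → ℝ := fun m k =>
    if |matsubaraFreq β M k.1| < 2 * η m ∧ |e k.2| < η m then 1 else 0 with hind
  have hpt : ∀ k : FreqMomentum L M,
      (1 - salmhoferCutoff ((matsubaraFreq β M k.1 ^ 2 + e k.2 ^ 2) / Λ ^ 2)) /
          Real.sqrt (matsubaraFreq β M k.1 ^ 2 + e k.2 ^ 2) ≤
        ∑ m ∈ range (T + 1), 2 / η m * ind m k := by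
    intro k
    set ω := matsubaraFreq β M k.1 with hω
    set ξ := e k.2 with hξ
    have hwmem := salmhoferCutoff_mem_Icc ((ω ^ 2 + ξ ^ 2) / Λ ^ 2)
    have hRHS0 : 0 ≤ ∑ m ∈ range (T + 1), 2 / η m * ind m k := sum_nonneg fun m _ => by
      have := hηpos m
      simp only [hind]
      split_ifs <;> positivity
    by_cases hlt : ω ^ 2 + ξ ^ 2 < Λ ^ 2
    · -- both `|ω| < Λ` and `|ξ| < Λ`
      have hωΛ : |ω| < Λ := abs_lt.2 (abs_lt_of_sq_lt_sq' (by nlinarith [sq_nonneg ξ] : ω ^ 2 < Λ ^ 2) hΛ.le)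
      have hξΛ : |ξ| < Λ := abs_lt.2 (abs_lt_of_sq_lt_sq' (by nlinarith [sq_nonneg ω] : ξ ^ 2 < Λ ^ 2) hΛ.le)
      have hωlow : ω₀ ≤ |ω| := pi_div_le_abs_matsubaraFreq hβ k.1
      have hsqrt : max |ω| |ξ| ≤ Real.sqrt (ω ^ 2 + ξ ^ 2) := by
        refine max_le ?_ ?_
        · rw [← Real.sqrt_sq_eq_abs]; exact Real.sqrt_le_sqrt (by nlinarith [sq_nonneg ξ])
        · rw [← Real.sqrt_sq_eq_abs]; exact Real.sqrt_le_sqrt (by nlinarith [sq_nonneg ω])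
      have hmaxpos : 0 < max |ω| |ξ| := lt_of_lt_of_le (lt_of_lt_of_le hω₀pos hωlow) (le_max_left _ _)
      calc (1 - salmhoferCutoff ((ω ^ 2 + ξ ^ 2) / Λ ^ 2)) / Real.sqrt (ω ^ 2 + ξ ^ 2)
          ≤ 1 / Real.sqrt (ω ^ 2 + ξ ^ 2) := by
            refine div_le_div_of_nonneg_right (by linarith [hwmem.1]) (Real.sqrt_nonneg _)
        _ ≤ 1 / max |ω| |ξ| := one_div_le_one_div_of_le hmaxpos hsqrt
        _ ≤ ∑ m ∈ range (T + 1), 2 / (Λ * ((2 : ℝ) ^ m)⁻¹) *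
              (if |ω| < 2 * (Λ * ((2 : ℝ) ^ m)⁻¹) ∧ |ξ| < Λ * ((2 : ℝ) ^ m)⁻¹ then 1 else 0) :=
            inv_max_le_dyadic_sum hΛ hω₀pos hωlow hωΛ hξΛ hT
        _ = ∑ m ∈ range (T + 1), 2 / η m * ind m k := by simp only [hind, hη, hω, hξ]
    · -- the weight is `1`: the summand vanishes
      have hw1 : salmhoferCutoff ((ω ^ 2 + ξ ^ 2) / Λ ^ 2) = 1 := by
        refine salmhoferCutoff_of_ge ?_
        rw [le_div_iff₀ (by positivity)]
        linarith
      rw [hw1, sub_self, zero_div]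
      exact hRHS0
  -- sum the majorant, exchange the summations, count
  have hcountω : ∀ m, ((((univ : Finset (MatsubaraIdx M)).filter fun i => |matsubaraFreq β M i| < 2 * η m).card : ℕ) : ℝ) ≤
      2 * η m * β / Real.pi + 3 := fun m =>
    card_filter_matsubaraFreq_le hβ (by have := hηpos m; positivity) _ fun i hi => (mem_filter.1 hi).2.le
  have hcountk : ∀ m, ((((univ : Finset (TorusSite 2 L)).filter fun k => |e k| < η m).card : ℕ) : ℝ) ≤
      c₁ * η m * (L : ℝ) ^ 2 + c₂ * L := fun m => hcount (η m) (hηpos m) (hηle m)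
  have hsumind : ∀ m, ∑ k : FreqMomentum L M, ind m k =
      ((((univ : Finset (MatsubaraIdx M)).filter fun i => |matsubaraFreq β M i| < 2 * η m).card : ℕ) : ℝ) *
        ((((univ : Finset (TorusSite 2 L)).filter fun k => |e k| < η m).card : ℕ) : ℝ) := by
    intro m
    simp only [hind]
    rw [sum_boole, ← Nat.cast_mul, ← card_filter_freqMomentum_eq]
  calc ∑ k : FreqMomentum L M, (1 - salmhoferCutoff ((matsubaraFreq β M k.1 ^ 2 + e k.2 ^ 2) / Λ ^ 2)) /
          Real.sqrt (matsubaraFreq β M k.1 ^ 2 + e k.2 ^ 2)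
      ≤ ∑ k : FreqMomentum L M, ∑ m ∈ range (T + 1), 2 / η m * ind m k := sum_le_sum fun k _ => hpt k
    _ = ∑ m ∈ range (T + 1), 2 / η m * ∑ k : FreqMomentum L M, ind m k := by
        rw [sum_comm]; exact sum_congr rfl fun m _ => by rw [mul_sum]
    _ ≤ ∑ m ∈ range (T + 1), 2 / η m * ((2 * η m * β / Real.pi + 3) * (c₁ * η m * (L : ℝ) ^ 2 + c₂ * L)) := by
        refine sum_le_sum fun m _ => mul_le_mul_of_nonneg_left ?_ (by have := hηpos m; positivity)
        rw [hsumind]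
        exact mul_le_mul (hcountω m) (hcountk m) (Nat.cast_nonneg _) (by have := hηpos m; positivity)
    _ = ∑ m ∈ range (T + 1), ((4 * c₁ * β * (L : ℝ) ^ 2 / Real.pi) * η m +
          (6 * c₁ * (L : ℝ) ^ 2 + 4 * c₂ * β * L / Real.pi) + (6 * c₂ * L) * (η m)⁻¹) := by
        refine sum_congr rfl fun m _ => ?_
        have := (hηpos m).ne'
        field_simp
        ring
    _ = (4 * c₁ * β * (L : ℝ) ^ 2 / Real.pi) * ∑ m ∈ range (T + 1), η m +
          ((T : ℝ) + 1) * (6 * c₁ * (L : ℝ) ^ 2 + 4 * c₂ * β * L / Real.pi) +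
          (6 * c₂ * L) * ∑ m ∈ range (T + 1), (η m)⁻¹ := by
        rw [sum_add_distrib, sum_add_distrib, sum_const, card_range, nsmul_eq_mul, Nat.cast_add, Nat.cast_one,
          mul_sum, mul_sum]
    _ ≤ (4 * c₁ * β * (L : ℝ) ^ 2 / Real.pi) * (2 * Λ) +
          (2 * Λ * β / Real.pi) * (6 * c₁ * (L : ℝ) ^ 2 + 4 * c₂ * β * L / Real.pi) +
          (6 * c₂ * L) * (4 * β / Real.pi) := by
        have hA : ∑ m ∈ range (T + 1), η m ≤ 2 * Λ := sum_dyadic_le hΛ.le (T + 1)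
        have hB : ((T : ℝ) + 1) ≤ 2 * Λ * β / Real.pi := hT1.trans h2T'
        have hC : ∑ m ∈ range (T + 1), (η m)⁻¹ ≤ 4 * β / Real.pi := by
          refine (sum_inv_dyadic_le hΛ (T + 1)).trans ?_
          rw [pow_succ, div_le_iff₀ hΛ]
          calc (2 : ℝ) ^ T * 2 ≤ 2 * Λ * β / Real.pi * 2 := by nlinarith
            _ = 4 * β / Real.pi * Λ := by ring
        gcongr
    _ ≤ (7 * c₁ + 4 * c₂) * Λ * β * (L : ℝ) ^ 2 := by
        have hπ3 : (3 : ℝ) ≤ Real.pi := Real.pi_gt_three.le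
        have hπne : Real.pi ≠ 0 := hπ.ne'
        have hπ9 : (9 : ℝ) ≤ Real.pi ^ 2 := by
          have h := pow_le_pow_left₀ (by norm_num : (0 : ℝ) ≤ 3) hπ3 2
          norm_num at h
          exact h
        -- `Λ·L ≥ π` from `π/β ≤ Λ` and `β ≤ L`
        have hΛL : Real.pi ≤ Λ * L := by
          have h1 : Real.pi ≤ Λ * β := by rwa [div_le_iff₀ hβ] at hΛβ
          calc Real.pi ≤ Λ * β := h1
            _ ≤ Λ * L := mul_le_mul_of_nonneg_left hβL hΛ.le
        have hX : 0 ≤ c₁ * Λ * β * (L : ℝ) ^ 2 := by positivity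
        have hY : 0 ≤ Λ * c₂ * β ^ 2 * L := by positivity
        have hZ : 0 ≤ c₂ * β * L := by positivity
        have h1 : (4 * c₁ * β * (L : ℝ) ^ 2 / Real.pi) * (2 * Λ) + (2 * Λ * β / Real.pi) * (6 * c₁ * (L : ℝ) ^ 2) ≤
            7 * c₁ * Λ * β * (L : ℝ) ^ 2 := by
          have e : (4 * c₁ * β * (L : ℝ) ^ 2 / Real.pi) * (2 * Λ) + (2 * Λ * β / Real.pi) * (6 * c₁ * (L : ℝ) ^ 2) =
              20 * (c₁ * Λ * β * (L : ℝ) ^ 2) / Real.pi := by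
            field_simp
            ring
          rw [e]
          calc 20 * (c₁ * Λ * β * (L : ℝ) ^ 2) / Real.pi ≤ 20 * (c₁ * Λ * β * (L : ℝ) ^ 2) / 3 :=
                div_le_div_of_nonneg_left (by positivity) (by norm_num) hπ3
            _ ≤ 7 * c₁ * Λ * β * (L : ℝ) ^ 2 := by linarith
        have h2 : (2 * Λ * β / Real.pi) * (4 * c₂ * β * L / Real.pi) ≤ Λ * c₂ * β * (L : ℝ) ^ 2 := by
          have e : (2 * Λ * β / Real.pi) * (4 * c₂ * β * L / Real.pi) = 8 * (Λ * c₂ * β ^ 2 * L) / Real.pi ^ 2 := by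
            field_simp
            ring
          rw [e]
          have hβ2 : Λ * c₂ * β ^ 2 * L ≤ Λ * c₂ * β * (L : ℝ) ^ 2 := by
            have : β ^ 2 * (L : ℝ) ≤ β * (L : ℝ) ^ 2 := by
              have e1 : β * (L : ℝ) ^ 2 - β ^ 2 * L = β * L * (L - β) := by ring
              have e2 : 0 ≤ β * L * ((L : ℝ) - β) := mul_nonneg (mul_nonneg hβ.le hL.le) (sub_nonneg.2 hβL)
              linarith
            calc Λ * c₂ * β ^ 2 * L = Λ * c₂ * (β ^ 2 * L) := by ring
              _ ≤ Λ * c₂ * (β * (L : ℝ) ^ 2) := mul_le_mul_of_nonneg_left this (by positivity)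
              _ = Λ * c₂ * β * (L : ℝ) ^ 2 := by ring
          calc 8 * (Λ * c₂ * β ^ 2 * L) / Real.pi ^ 2 ≤ 8 * (Λ * c₂ * β ^ 2 * L) / 9 :=
                div_le_div_of_nonneg_left (by positivity) (by norm_num) hπ9
            _ ≤ Λ * c₂ * β * (L : ℝ) ^ 2 := by linarith
        -- the rounding term, now absorbed by `ΛL ≥ π`: `24c₂βL/π ≤ (24/π²)·Λc₂βL² ≤ 3·Λc₂βL²`
        have h3 : (6 * c₂ * L) * (4 * β / Real.pi) ≤ 3 * (Λ * c₂ * β * (L : ℝ) ^ 2) := by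
          have e : (6 * c₂ * L) * (4 * β / Real.pi) = 24 * (c₂ * β * L) / Real.pi := by
            field_simp
            ring
          rw [e, div_le_iff₀ hπ]
          -- `24·(c₂βL) ≤ 3Λc₂βL²·π` since `ΛL·π ≥ π² ≥ 9 ≥ 8`
          have hk : 8 ≤ Λ * L * Real.pi := by nlinarith
          have : 24 * (c₂ * β * L) ≤ (c₂ * β * L) * (3 * (Λ * L * Real.pi)) := by nlinarith
          calc 24 * (c₂ * β * L) ≤ (c₂ * β * L) * (3 * (Λ * L * Real.pi)) := this
            _ = 3 * (Λ * c₂ * β * (L : ℝ) ^ 2) * Real.pi := by ring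
        have e4 : (7 * c₁ + 4 * c₂) * Λ * β * (L : ℝ) ^ 2 =
            7 * c₁ * Λ * β * (L : ℝ) ^ 2 + Λ * c₂ * β * (L : ℝ) ^ 2 + 3 * (Λ * c₂ * β * (L : ℝ) ^ 2) := by ring
        have e5 : (4 * c₁ * β * (L : ℝ) ^ 2 / Real.pi) * (2 * Λ) +
            (2 * Λ * β / Real.pi) * (6 * c₁ * (L : ℝ) ^ 2 + 4 * c₂ * β * L / Real.pi) + (6 * c₂ * L) * (4 * β / Real.pi) =
            ((4 * c₁ * β * (L : ℝ) ^ 2 / Real.pi) * (2 * Λ) + (2 * Λ * β / Real.pi) * (6 * c₁ * (L : ℝ) ^ 2)) +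
              (2 * Λ * β / Real.pi) * (4 * c₂ * β * L / Real.pi) + (6 * c₂ * L) * (4 * β / Real.pi) := by ring
        rw [e4, e5]
        linarith

/-- **The frame-band instance, scale-linear form**: for the renormalised band `e_K = nambuXiCT L μ K` with the level count
`#{k⃗ : |e_K(k⃗)| < η} ≤ c₁ηL² + c₂L` (`0 < η ≤ Λ`), `0 < β ≤ L` and `π/β ≤ Λ`:
`Σ_{(i,k⃗)} (1 − w^K_Λ(i,k⃗))/√(ω_i² + e_K(k⃗)²) ≤ (7c₁ + 4c₂)·Λ·βL²` — the soft-line phase-space sum is LINEAR in the scale.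
[cite: PedraSalmhofer2008, Lemma 5.1] -/
theorem sum_one_sub_hubbardCutoffWeightCT_div_sqrt_le_linear {L M : ℕ} [NeZero L] {β : ℝ} (hβ : 0 < β) (μ : ℝ) (K : TrigPolyC4v)
    {Λ c₁ c₂ : ℝ} (hΛ : 0 < Λ) (hΛβ : Real.pi / β ≤ Λ) (hβL : β ≤ L) (hc₁ : 0 ≤ c₁) (hc₂ : 0 ≤ c₂)
    (hcount : ∀ η : ℝ, 0 < η → η ≤ Λ →
      (((univ : Finset (TorusSite 2 L)).filter fun k => |nambuXiCT L μ K k| < η).card : ℝ) ≤ c₁ * η * (L : ℝ) ^ 2 + c₂ * L) :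
    ∑ k : FreqMomentum L M, (1 - hubbardCutoffWeightCT L M β μ K Λ k) /
        Real.sqrt (matsubaraFreq β M k.1 ^ 2 + nambuXiCT L μ K k.2 ^ 2) ≤
      (7 * c₁ + 4 * c₂) * Λ * β * (L : ℝ) ^ 2 :=
  sum_one_sub_cutoff_div_sqrt_le_linear hβ (nambuXiCT L μ K) hΛ hΛβ hβL hc₁ hc₂ hcount

end Literature.MathematicalPhysics.QuantumLattice

end
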